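/-
Origin: expansion seat `planner-pub-hodgecm-pv10-0`, handover 2026-08-18T03:28:07Z / update 03:29:07Z (`HOME/pub-hodgecm-pv10/lean/Pv10/NoSmallSubgroups.lean`, md5 f7c6fe0a, 328 lines);
landed by the gen-5 packager in gate run 18 as `HodgeCM/PerL34/NoSmallSubgroups.lean` (verbatim).
-/
/-
Copyright: HodgeCM publication cell (pub-hodgecm), DAG node N31g (prover pv10).
Released under the package licence.

# N31g — PerL v5 Lemma 4.2(b), proof step "unramified at almost all places"
# (tex ll. 623–631): the circle has no small subgroups

Source under adjudication (NOT cited as a fact; this file PROVES the step):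
PerL v5 = `inputs/2001/summits__hodge-w-picard-modular-quadrilinear-period-galois-
closure__free__y1__paper__paper.tex`, ll. 623–628, verbatim:

  623: ... At almost all $v$ the data are unramified. Indeed, by continuity $\chi'$ maps a
       neighbourhood of $1$ in $\A^1_L$, which
  624: contains the compact subgroup $\prod_{v\notin S}\U(1)(\mathcal O_v)$ for some finite
       set $S$ of places, into an open arc of the
  625: circle of length $<\pi$; the image of that subgroup is a subgroup of the circle
       contained in the arc, hence trivial (the circle
  626: has no small subgroups); so $\chi'_v$ is trivial on $\U(1)(\mathcal O_v)$ for
       $v\notin S$, and at a non-split finite $v$ the group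
  627: $\U(W_i)(L_{0,v})=L_w^1$ is compact and \emph{equals} $\U(1)(\mathcal O_v)$ (a norm-one
       element of $L_w$ is a unit at the unique
  628: place $w$ above $v$), so $\chi'_v=1$ there.

This is the v3 REPAIR of reviewer R2's FIRST ERROR (v2 ll. 561–562, the false principle
"a continuous character of the compact group [U(1)] is trivial on an open subgroup").

What is proved here, with Mathlib only (no posited data, no cited facts):

* `exists_nat_mul_cos_nonpos`, `Circle.exists_pow_re_nonpos`,
  `Circle.subgroup_eq_bot_of_forall_re_pos`, and `N31g_core_noSmallSubgroups_holds` (= the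
  carver's `HodgeCM.PerL34.N31g_core_noSmallSubgroups`, `PerL34/Chars.lean`, the SAME Prop
  verbatim: `∃ W ∈ nhds (1 : Circle), ∀ H : Subgroup Circle, (H : Set Circle) ⊆ W → H = ⊥`)
  — **the circle has no small subgroups**:
  a subgroup of the unit circle contained in the open right half-plane (an open arc of
  length `π` around `1`; a fortiori any shorter arc around `1`) is trivial (ll. 625–626).
* `subgroup_le_ker_of_forall_re_pos`, `exists_nhds_one_forall_subgroup_le_ker` — a
  continuous unitary character of ANY topological group kills every subgroup contained in
  the neighbourhood `χ ⁻¹' {re > 0}` of the identity (ll. 623–625).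
* `RestrictedProduct.exists_finset_forall_mem_of_nhds_one` — in a restricted product
  `Πʳ i, [R i, B i]` with respect to OPEN subgroups `B i`, every neighbourhood of `1`
  contains the box subgroup `∏_{i ∉ T} B i` for some finite `T` (l. 624).
* `RestrictedProduct.continuousChar_trivial_on_almost_all` — **the step itself** in
  restricted-product generality: a continuous character `χ : Πʳ i, [R i, B i] →* Circle` is
  trivial on (the image of) `B i` for all `i` outside a finite set `T` (l. 626); and
  `RestrictedProduct.continuousChar_local_trivial_of_top` — at an index where `B i` is the
  whole local group (the non-split places, l. 627: `U(W_i)(L_{0,v}) = U(1)(𝒪_v)`), the local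
  component `χ_i` is identically `1` (l. 628).
* `valuation_eq_one_of_mul_conj_eq_one` — the algebra behind l. 627 "a norm-one element of
  `L_w` is a unit at the unique place `w` above `v`": if a valuation is invariant under the
  conjugation `σ` (this is where uniqueness of `w | v` enters), then `x · σ x = 1 ⇒ v x = 1`.

The adelic specialisation (`ι` = finite places of `L₀`, `R v = U(W_i)(L_{0,v})`,
`B v = U(1)(𝒪_v)`) is an instance of these statements once the cell's D3/D4 vocabulary
(LEMMAS.md §3) names those groups; nothing here depends on it.
-/
import Mathlib.Analysis.SpecialFunctions.Complex.Circle
import Mathlib.Topology.Algebra.RestrictedProduct.TopologicalSpace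
import Mathlib.RingTheory.Valuation.Basic

set_option autoImplicit false

namespace HodgeCM.PerL34.NoSmallSubgroups

open Filter Topology
open scoped RestrictedProduct

/-! ### A. The circle has no small subgroups (ll. 625–626) -/

/-- If `0 < θ ≤ π` then some natural multiple `n • θ` lies in `[π/2, 3π/2]`,
so `cos (n θ) ≤ 0`. -/
theorem exists_nat_mul_cos_nonpos {θ : ℝ} (h0 : 0 < θ) (hπ : θ ≤ Real.pi) :
    ∃ n : ℕ, Real.cos (n * θ) ≤ 0 := by
  refine ⟨⌈(Real.pi / 2) / θ⌉₊, Real.cos_nonpos_of_pi_div_two_le_of_le ?_ ?_⟩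
  · have h1 : (Real.pi / 2) / θ ≤ (⌈(Real.pi / 2) / θ⌉₊ : ℝ) := Nat.le_ceil _
    have h2 : (Real.pi / 2) / θ * θ = Real.pi / 2 := by field_simp
    calc Real.pi / 2 = (Real.pi / 2) / θ * θ := h2.symm
      _ ≤ (⌈(Real.pi / 2) / θ⌉₊ : ℝ) * θ := mul_le_mul_of_nonneg_right h1 h0.le
  · have h1 : (⌈(Real.pi / 2) / θ⌉₊ : ℝ) < (Real.pi / 2) / θ + 1 :=
      Nat.ceil_lt_add_one (by positivity)
    have h2 : (⌈(Real.pi / 2) / θ⌉₊ : ℝ) * θ < ((Real.pi / 2) / θ + 1) * θ :=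
      mul_lt_mul_of_pos_right h1 h0
    have h3 : ((Real.pi / 2) / θ + 1) * θ = Real.pi / 2 + θ := by field_simp
    linarith

/-- For `z` on the unit circle with `z ≠ 1`, some power of `z` has non-positive real part. -/
theorem Circle.exists_pow_re_nonpos (z : Circle) (hz : z ≠ 1) :
    ∃ n : ℕ, ((z ^ n : Circle) : ℂ).re ≤ 0 := by
  have hθ0 : 0 < |Complex.arg (z : ℂ)| := by
    rw [abs_pos]
    intro h
    exact hz (Circle.arg_eq_zero.mp h)
  have hθπ : |Complex.arg (z : ℂ)| ≤ Real.pi := Complex.abs_arg_le_pi _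
  obtain ⟨n, hn⟩ := exists_nat_mul_cos_nonpos hθ0 hθπ
  refine ⟨n, ?_⟩
  have key : ((z ^ n : Circle) : ℂ).re = Real.cos (n * Complex.arg (z : ℂ)) := by
    rw [Circle.coe_pow]
    conv_lhs => rw [← Complex.norm_mul_exp_arg_mul_I (z : ℂ)]
    rw [Circle.norm_coe, Complex.ofReal_one, one_mul, ← Complex.exp_nat_mul]
    have : (n : ℂ) * (Complex.arg (z : ℂ) * Complex.I)
        = ((n * Complex.arg (z : ℂ) : ℝ) : ℂ) * Complex.I := by
      push_cast; ring
    rw [this, Complex.exp_ofReal_mul_I_re]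
  rw [key]
  have habs : (n : ℝ) * |Complex.arg (z : ℂ)| = |(n : ℝ) * Complex.arg (z : ℂ)| := by
    rw [abs_mul, Nat.abs_cast]
  rwa [habs, Real.cos_abs] at hn

/-- **The circle has no small subgroups** (PerL v5 ll. 625–626: "the image of that subgroup
is a subgroup of the circle contained in the arc, hence trivial (the circle has no small
subgroups)"): a subgroup of the unit circle all of whose elements have positive real part —
i.e. contained in the open arc of length `π` centred at `1` — is trivial. -/
theorem Circle.subgroup_eq_bot_of_forall_re_pos (H : Subgroup Circle)
    (hH : ∀ z ∈ H, 0 < ((z : Circle) : ℂ).re) : H = ⊥ := by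
  rw [Subgroup.eq_bot_iff_forall]
  intro z hz
  by_contra hne
  obtain ⟨n, hn⟩ := Circle.exists_pow_re_nonpos z hne
  exact absurd (hH (z ^ n) (H.pow_mem hz n)) (not_lt.mpr hn)

/-- The open right half-plane trace `{z | 0 < re z}` is a neighbourhood of `1` in the circle. -/
theorem Circle.setOf_re_pos_mem_nhds_one :
    {z : Circle | 0 < (z : ℂ).re} ∈ 𝓝 (1 : Circle) := by
  apply IsOpen.mem_nhds
  · exact isOpen_lt continuous_const (Complex.continuous_re.comp continuous_subtype_val)
  · show 0 < ((1 : Circle) : ℂ).re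
    simp

/-- **N31g core, in the carver's typing** (`HodgeCM.PerL34.N31g_core_noSmallSubgroups`,
`Carver/PerL34/Chars.lean`, VERBATIM the same Prop): "there is a neighbourhood of `1` in the
circle containing no non-trivial subgroup" — PerL v5 ll. 623–626.  Witness: `W = {re > 0}`. -/
theorem N31g_core_noSmallSubgroups_holds :
    ∃ W ∈ nhds (1 : Circle), ∀ H : Subgroup Circle, (H : Set Circle) ⊆ W → H = ⊥ :=
  ⟨{z : Circle | 0 < (z : ℂ).re}, Circle.setOf_re_pos_mem_nhds_one,
    fun H hH => Circle.subgroup_eq_bot_of_forall_re_pos H (fun _ hz => hH hz)⟩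

/-! ### B. Continuous unitary characters kill small subgroups (ll. 623–625) -/

section Character

variable {G : Type*} [Group G]

/-- A unitary character kills every subgroup on which it has positive real part. -/
theorem subgroup_le_ker_of_forall_re_pos (χ : G →* Circle) (K : Subgroup G)
    (hK : ∀ k ∈ K, 0 < ((χ k : Circle) : ℂ).re) : K ≤ χ.ker := by
  have hbot : K.map χ = ⊥ :=
    Circle.subgroup_eq_bot_of_forall_re_pos _ (by
      rintro _ ⟨k, hk, rfl⟩
      exact hK k hk)
  intro k hk
  have hmem : χ k ∈ K.map χ := Subgroup.mem_map_of_mem χ hk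
  rw [hbot, Subgroup.mem_bot] at hmem
  exact (MonoidHom.mem_ker).mpr hmem

variable [TopologicalSpace G]

/-- The set `{g | 0 < re (χ g)}` is a neighbourhood of `1` for a continuous character `χ`
(PerL v5 ll. 623–625: "by continuity `χ′` maps a neighbourhood of `1` … into an open arc of
the circle"). -/
theorem preimage_re_pos_mem_nhds_one (χ : G →* Circle) (hχ : Continuous χ) :
    (χ : G → Circle) ⁻¹' {z : Circle | 0 < (z : ℂ).re} ∈ 𝓝 (1 : G) := by
  apply (IsOpen.preimage hχ _).mem_nhds
  · show 0 < ((χ 1 : Circle) : ℂ).re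
    simp
  · exact isOpen_lt continuous_const (Complex.continuous_re.comp continuous_subtype_val)

/-- A continuous unitary character of a topological group kills every subgroup contained in
the neighbourhood `χ ⁻¹' {re > 0}` of the identity; in particular there is a neighbourhood
of `1` all of whose subgroups lie in `ker χ`. -/
theorem exists_nhds_one_forall_subgroup_le_ker (χ : G →* Circle) (hχ : Continuous χ) :
    ∃ U ∈ 𝓝 (1 : G), ∀ K : Subgroup G, (K : Set G) ⊆ U → K ≤ χ.ker :=
  ⟨_, preimage_re_pos_mem_nhds_one χ hχ,
    fun K hK => subgroup_le_ker_of_forall_re_pos χ K (fun _ hk => hK hk)⟩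

end Character

/-! ### C. Restricted products: neighbourhoods of `1` contain cofinite boxes (l. 624) -/

section Restricted

variable {ι : Type*} {R : ι → Type*} [Π i, Group (R i)]
  {S : ι → Type*} [Π i, SetLike (S i) (R i)] [∀ i, SubgroupClass (S i) (R i)]
  {B : Π i, S i}

/-- The box subgroup `K_T = {x | x i ∈ B i for all i, x i = 1 for i ∈ T}` of the
restricted product (`= ∏_{i ∉ T} B i × ∏_{i ∈ T} {1}`). -/
def RestrictedProduct.boxSubgroup (B : Π i, S i) (T : Finset ι) :
    Subgroup (Πʳ i, [R i, B i]) where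
  carrier := {x | (∀ i, x i ∈ B i) ∧ ∀ i ∈ T, x i = 1}
  mul_mem' {x y} hx hy :=
    ⟨fun i => by simpa using mul_mem (hx.1 i) (hy.1 i),
     fun i hi => by simp [hx.2 i hi, hy.2 i hi]⟩
  one_mem' := ⟨fun i => by simp [one_mem], fun i _ => by simp⟩
  inv_mem' {x} hx :=
    ⟨fun i => by simpa using inv_mem (hx.1 i), fun i hi => by simp [hx.2 i hi]⟩

/-- (Ported verbatim from the HodgeCMPerL package; no docstring in the source.) -/
theorem RestrictedProduct.mem_boxSubgroup_iff (T : Finset ι) (x : Πʳ i, [R i, B i]) :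
    x ∈ RestrictedProduct.boxSubgroup B T ↔ (∀ i, x i ∈ B i) ∧ ∀ i ∈ T, x i = 1 :=
  Iff.rfl

/-- The local inclusion at `i` lands in the box subgroup `K_T` whenever `i ∉ T` and the
local element lies in `B i`. -/
theorem RestrictedProduct.mulSingle_mem_boxSubgroup [DecidableEq ι] (T : Finset ι)
    {i : ι} (hi : i ∉ T) {b : R i} (hb : b ∈ B i) :
    RestrictedProduct.mulSingle B i b ∈ RestrictedProduct.boxSubgroup B T := by
  rw [RestrictedProduct.mem_boxSubgroup_iff]
  refine ⟨fun j => ?_, fun j hj => ?_⟩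
  · by_cases hji : j = i
    · subst hji
      rw [RestrictedProduct.mulSingle_eq_same]
      exact hb
    · rw [RestrictedProduct.mulSingle_eq_of_ne B b hji]
      exact one_mem _
  · have hji : j ≠ i := fun h => hi (h ▸ hj)
    exact RestrictedProduct.mulSingle_eq_of_ne B b hji

variable [Π i, TopologicalSpace (R i)]

/-- In a restricted product `Πʳ i, [R i, B i]` with respect to OPEN subgroups `B i`, every
neighbourhood `U` of `1` contains the box subgroup `∏_{i ∉ T} B i × ∏_{i ∈ T} {1}` for some
finite set `T` of indices (PerL v5 l. 624: "a neighbourhood of 1 in 𝔸¹_L, which contains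
the compact subgroup ∏_{v∉S} U(1)(𝒪_v) for some finite set S of places"). -/
theorem RestrictedProduct.exists_finset_forall_mem_of_nhds_one
    (hBopen : ∀ i, IsOpen (B i : Set (R i)))
    {U : Set (Πʳ i, [R i, B i])} (hU : U ∈ 𝓝 (1 : Πʳ i, [R i, B i])) :
    ∃ T : Finset ι, ∀ x : Πʳ i, [R i, B i],
      (∀ i, x i ∈ B i) → (∀ i ∈ T, x i = 1) → x ∈ U := by
  -- the integral point `1` of the box `Π i, B i`
  let e : Π i, (fun i => (B i : Set (R i))) i := fun i => ⟨1, one_mem (B i)⟩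
  have he : RestrictedProduct.structureMap R (fun i => (B i : Set (R i))) cofinite e
      = (1 : Πʳ i, [R i, B i]) := by
    ext i
    rfl
  have hU' : U ∈ Filter.map
      (RestrictedProduct.structureMap R (fun i => (B i : Set (R i))) cofinite) (𝓝 e) := by
    rw [← RestrictedProduct.nhds_eq_map_structureMap hBopen e, he]
    exact hU
  rw [Filter.mem_map, nhds_pi, Filter.mem_pi'] at hU'
  obtain ⟨T, t, ht, hTt⟩ := hU'
  refine ⟨T, fun x hxB hxT => ?_⟩
  -- lift `x` to the box
  let y : Π i, (fun i => (B i : Set (R i))) i := fun i => ⟨x i, hxB i⟩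
  have hy : RestrictedProduct.structureMap R (fun i => (B i : Set (R i))) cofinite y = x := by
    ext i
    rfl
  have hyt : y ∈ Set.pi (↑T) t := by
    intro i hi
    have hyi : y i = e i := Subtype.ext (hxT i (Finset.mem_coe.mp hi))
    rw [hyi]
    exact mem_of_mem_nhds (ht i)
  have := hTt hyt
  rwa [Set.mem_preimage, hy] at this

/-! ### D. The step: a continuous character is unramified at almost all places (l. 626) -/

/-- **PerL v5 Lemma 4.2(b), ll. 623–626** in restricted-product generality.  Let
`χ : Πʳ i, [R i, B i] →* Circle` be a continuous unitary character, all `B i` being open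
subgroups.  Then there is a finite set `T` of indices such that for every `i ∉ T` the local
component `χ_i = χ ∘ (inclusion at i)` is trivial on `B i`.
(Adelic reading: `ι` = finite places `v` of `L₀`, `R v = U(W_i)(L_{0,v})`,
`B v = U(1)(𝒪_v)`, `T = S`: "so `χ′_v` is trivial on `U(1)(𝒪_v)` for `v ∉ S`".) -/
theorem RestrictedProduct.continuousChar_trivial_on_almost_all [DecidableEq ι]
    (hBopen : ∀ i, IsOpen (B i : Set (R i)))
    (χ : (Πʳ i, [R i, B i]) →* Circle) (hχ : Continuous χ) :
    ∃ T : Finset ι, ∀ i, i ∉ T → ∀ b : R i, b ∈ B i →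
      χ (RestrictedProduct.mulSingle B i b) = 1 := by
  obtain ⟨U, hU, hker⟩ := exists_nhds_one_forall_subgroup_le_ker χ hχ
  obtain ⟨T, hT⟩ := RestrictedProduct.exists_finset_forall_mem_of_nhds_one hBopen hU
  have hKU : ((RestrictedProduct.boxSubgroup B T : Subgroup (Πʳ i, [R i, B i])) :
      Set (Πʳ i, [R i, B i])) ⊆ U :=
    fun x hx => hT x ((RestrictedProduct.mem_boxSubgroup_iff T x).mp hx).1
      ((RestrictedProduct.mem_boxSubgroup_iff T x).mp hx).2
  have hKker := hker _ hKU
  refine ⟨T, fun i hi b hb => ?_⟩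
  exact (MonoidHom.mem_ker).mp
    (hKker (RestrictedProduct.mulSingle_mem_boxSubgroup T hi hb))

/-- `Filter.cofinite` phrasing of `RestrictedProduct.continuousChar_trivial_on_almost_all`:
for all but finitely many `i`, `χ_i` is trivial on `B i`. -/
theorem RestrictedProduct.continuousChar_eventually_trivial [DecidableEq ι]
    (hBopen : ∀ i, IsOpen (B i : Set (R i)))
    (χ : (Πʳ i, [R i, B i]) →* Circle) (hχ : Continuous χ) :
    ∀ᶠ i in cofinite, ∀ b : R i, b ∈ B i → χ (RestrictedProduct.mulSingle B i b) = 1 := by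
  obtain ⟨T, hT⟩ := RestrictedProduct.continuousChar_trivial_on_almost_all hBopen χ hχ
  refine Filter.mem_of_superset T.finite_toSet.compl_mem_cofinite ?_
  intro i hi
  exact hT i (fun h => hi (Finset.mem_coe.mpr h))

/-- **PerL v5 ll. 626–628 (non-split places).**  At an index `i ∉ T` where the
distinguished subgroup `B i` is the whole local group — at a non-split finite place
`U(W_i)(L_{0,v}) = L_w^1` *equals* `U(1)(𝒪_v)` (l. 627) — the local component `χ_i` is
identically trivial: "so `χ′_v = 1` there" (l. 628). -/
theorem RestrictedProduct.continuousChar_local_trivial_of_top [DecidableEq ι]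
    (hBopen : ∀ i, IsOpen (B i : Set (R i)))
    (χ : (Πʳ i, [R i, B i]) →* Circle) (hχ : Continuous χ) :
    ∃ T : Finset ι, ∀ i, i ∉ T → (∀ b : R i, b ∈ B i) →
      ∀ b : R i, χ (RestrictedProduct.mulSingle B i b) = 1 := by
  obtain ⟨T, hT⟩ := RestrictedProduct.continuousChar_trivial_on_almost_all hBopen χ hχ
  exact ⟨T, fun i hi htop b => hT i hi b (htop b)⟩

end Restricted

/-! ### E. Norm-one elements are units when the place is unique (l. 627) -/

/-- **PerL v5 l. 627**: "a norm-one element of `L_w` is a unit at the unique place `w` above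
`v`".  Abstract form: let `v` be a valuation on a field `L` and `σ` a ring endomorphism of
`L` (complex conjugation of `L_w / L_{0,v}`) preserving `v` — this invariance
`v (σ x) = v x` is exactly where "`w` is the *unique* place above `v`" (non-split `v`) is
used.  Then every norm-one element `x σ(x) = 1` satisfies `v x = 1`, i.e. is a `w`-unit;
hence `L_w^1 ⊆ 𝒪_w^×` and `U(W_i)(L_{0,v}) = U(1)(𝒪_v)`. -/
theorem valuation_eq_one_of_mul_conj_eq_one {L Γ₀ : Type*} [Field L]
    [LinearOrderedCommGroupWithZero Γ₀] (v : Valuation L Γ₀) (σ : L →+* L)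
    (hσ : ∀ x, v (σ x) = v x) {x : L} (hx : x * σ x = 1) : v x = 1 := by
  have h : v x * v x = 1 := by
    calc v x * v x = v x * v (σ x) := by rw [hσ x]
      _ = v (x * σ x) := (map_mul v x (σ x)).symm
      _ = 1 := by rw [hx, map_one]
  rcases lt_trichotomy (v x) 1 with h1 | h1 | h1
  · exfalso
    have : v x * v x ≤ v x * 1 := mul_le_mul_right h1.le (v x)
    rw [h, mul_one] at this
    exact absurd h1 (not_lt.mpr this)
  · exact h1
  · exfalso
    have : v x * 1 ≤ v x * v x := mul_le_mul_right h1.le (v x)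
    rw [h, mul_one] at this
    exact absurd h1 (not_lt.mpr this)

end HodgeCM.PerL34.NoSmallSubgroups
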